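import Summits.CriticalPhenomena.Ising3DConformalLimit.Theses.SubPtolemyInterlacing
import Summits.CriticalPhenomena.Ising3DConformalLimit.Theorems.SubPtolemyFloor.Negative.ExponentWindow

/-!
# `Interlacing` (item stmt-CriticalPhenomena-15702): load-bearing analysis of the sub-Ptolemy crux

Negative / structural knowledge about the crux
`Summit.CriticalPhenomena.Ising3DConformalLimit.Theses.SubPtolemyInterlacing.Interlacing`
(route SubPtolemyInterlacing, r2: for all gaps `a, b, c ≥ 1` and `p k = k·e₁ ∈ ℤ³`,
`S₄(p0,pa,p(a+b),p(a+b+c))·G(p0,p(a+b))G(pa,p(a+b+c)) ≤ G(p0,pa)G(p(a+b),p(a+b+c))·G(p0,p(a+b+c))G(pa,p(a+b))`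
in the critical plus state `criticalCorr 3`), from its standing crux disprover (D-0016). THEOREM-ONLY, no new
definitions, no named facts.

* `criticalCorr_four_dup01/12/23`, `criticalCorr_two_self` — coincidence reductions (`σ² = 1`; `criticalCorr` is
  an expectation of spin MONOMIALS, so coincident points are honest).
* `interlacing_iff_allGaps` — the three side conditions `1 ≤ a`, `1 ≤ b`, `1 ≤ c` are NOT load-bearing: every
  degenerate case is an EQUALITY, so dropping them gives an equivalent statement (there is no
  `_false_without_gap` lemma; a refutation needs three positive gaps).
* `not_interlacing_strict_allGaps` — tightness: the strict all-gaps strengthening is FALSE (saturated at a zero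
  gap).
* `wickSPC_balanced_iff`, `not_wickSPC_of_lt_threshold`, `not_wickSPC_one`, `not_wickSPC_of_window`,
  `wickSPC_two_balanced` — the only load-bearing input is the critical law itself, and its GAUSSIAN caricature
  fails: for a Wick four-point function on the scale-free two-point function `n^{-s}` the inequality at the
  Ptolemy-balanced quadruple `(0,2,3,6)·e₁` holds iff `log₂(1+√2) ≤ s`; it fails at `s = 1` (the `ℤ³` GFF /
  `η = 0`) and at every `s = 2Δ` in the window of the sibling crux `SubPtolemyFloor`, and holds at the
  mean-field value `s = 2` of `d = 4`. So no argument valid for all reflection-positive / GKS /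
  Gaussian-dominated laws proves the crux (cf. Lebowitz 1974, Newman 1975: pairing-SUM bounds are Gaussian-true).
* `chain_spc_eq`, `not_chain_adjacent_penalised` — calibration on multiplicative (tree / Ising-chain) laws:
  SPC is an identity, and the variant penalising the adjacent pairing `(12)(34)` is false — the interlaced
  assignment of the pairings is load-bearing.
* `spc_iff_excess_le_defect`, `spc_iff_channel_ratio` — channel form of the inequality: `S₄P₂ ≤ P₁P₃` iff the
  four-point EXCESS over the adjacent pairing, weighted by the crossing pairing, is at most the adjacent pairing
  times the reflection-positivity defect `P₃ - P₂` (where the margin closes: `a = c = 1`, `b → ∞`, energy–energy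
  covariance against the curvature of `log G`).
* `spc_equidistant_iff` — on an equidistant quadruple (all six pair weights equal, e.g. the lattice tetrahedron
  `{0, e₁+e₂, e₁+e₃, e₂+e₃}`) any sub-Ptolemy inequality collapses to `S₄ ≤ G²`, i.e. with Griffiths II to exact
  factorisation: the off-line extension of the crux is not a candidate strengthening.
* `engine_inputs_insufficient` — for the picked line `Sketch` (stub 7, the "engine"): MMS monotonicity, RP
  log-convexity, Griffiths II, Lebowitz and the non-Lebowitz-regime hypothesis are jointly CONSISTENT with a
  violation of SPC (explicit rational witness = the Wick point of the Gaussian threshold), so the engine must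
  deliver a quantitative lower bound on the interlaced meeting probability, not a sign.
-/

noncomputable section

namespace Summit.CriticalPhenomena.Ising3DConformalLimit.InterlacingNegative

open Literature.Probability.LatticeModels Filter MeasureTheory
open Summit.CriticalPhenomena.Ising3DConformalLimit.Theses
open scoped Topology

/-! ### Coincident points (`σ² = 1`) -/

/-- `⟨σ_x σ_x σ_q σ_r⟩⁺_{β_c} = ⟨σ_q σ_r⟩⁺_{β_c}` on `ℤ^d`: the spin monomials agree pointwise (`σ_x² = 1`). [folklore] -/
theorem criticalCorr_four_dup01 (d : ℕ) (x q r : Site d) :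
    criticalCorr d 4 ![x, x, q, r] = criticalCorr d 2 ![q, r] := by
  simp only [criticalCorr]
  congr 1
  funext s
  simp [spinMonomial, Fin.prod_univ_four, Fin.prod_univ_two]

/-- `⟨σ_x σ_q σ_q σ_r⟩⁺_{β_c} = ⟨σ_x σ_r⟩⁺_{β_c}`. [folklore] -/
theorem criticalCorr_four_dup12 (d : ℕ) (x q r : Site d) :
    criticalCorr d 4 ![x, q, q, r] = criticalCorr d 2 ![x, r] := by
  simp only [criticalCorr]
  congr 1
  funext s
  simp only [spinMonomial, Fin.prod_univ_four, Fin.prod_univ_two, Fin.isValue, Matrix.cons_val_zero,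
    Matrix.cons_val_one, Matrix.cons_val]
  linear_combination (spinAt x s * spinAt r s) * spinAt_mul_self q s

/-- `⟨σ_x σ_q σ_r σ_r⟩⁺_{β_c} = ⟨σ_x σ_q⟩⁺_{β_c}`. [folklore] -/
theorem criticalCorr_four_dup23 (d : ℕ) (x q r : Site d) :
    criticalCorr d 4 ![x, q, r, r] = criticalCorr d 2 ![x, q] := by
  simp only [criticalCorr]
  congr 1
  funext s
  simp only [spinMonomial, Fin.prod_univ_four, Fin.prod_univ_two, Fin.isValue, Matrix.cons_val_zero,
    Matrix.cons_val_one, Matrix.cons_val]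
  linear_combination (spinAt x s * spinAt q s) * spinAt_mul_self r s

/-- `⟨σ_x σ_x⟩⁺_{β_c} = 1`: every box expectation is the integral of the constant `1` against a probability
measure, and `limUnder` of a constant sequence is that constant. [folklore] -/
theorem criticalCorr_two_self (d : ℕ) (x : Site d) : criticalCorr d 2 ![x, x] = 1 := by
  have hmono : spinMonomial ![x, x] = fun _ : SpinConfig (Site d) => (1 : ℝ) := by
    funext s
    simp [spinMonomial, Fin.prod_univ_two]
  have hconst : (fun L : ℕ => isingExpect (zdGraph d) (box d L) (criticalBeta d) 0 .plus
      (spinMonomial ![x, x])) = fun _ => (1 : ℝ) := by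
    funext L
    rw [hmono]
    simp [isingExpect]
  have ht : Tendsto (fun _ : ℕ => (1 : ℝ)) atTop (𝓝 1) := tendsto_const_nhds
  simp only [criticalCorr, plusExpect]
  rw [hconst]
  exact ht.limUnder_eq

/-! ### The gap hypotheses are decoration; the inequality is saturated at a zero gap -/

/-- **`1 ≤ a`, `1 ≤ b`, `1 ≤ c` are not load-bearing.** The crux is EQUIVALENT to the same inequality over
all `a b c : ℕ`: with a zero gap two of the four points coincide and both sides agree
(`a = 0`: `S₄ = G(pb,p(b+c))`, `G(p0,p0) = 1`; `b = 0`: `S₄ = G(p0,p(a+c))`, `G(pa,pa) = 1`;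
`c = 0`: `S₄ = G(p0,pa)`, `G(p(a+b),p(a+b)) = 1`). [folklore] -/
theorem interlacing_iff_allGaps :
    SubPtolemyInterlacing.Interlacing ↔
      ∀ a b c : ℕ,
        criticalCorr 3 4 ![((0 : ℕ) : ℤ) • (Pi.single 0 1 : Site 3), (a : ℤ) • (Pi.single 0 1 : Site 3),
            ((a + b : ℕ) : ℤ) • (Pi.single 0 1 : Site 3), ((a + b + c : ℕ) : ℤ) • (Pi.single 0 1 : Site 3)] *
            (criticalCorr 3 2 ![((0 : ℕ) : ℤ) • (Pi.single 0 1 : Site 3),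
                ((a + b : ℕ) : ℤ) • (Pi.single 0 1 : Site 3)] *
              criticalCorr 3 2 ![(a : ℤ) • (Pi.single 0 1 : Site 3),
                ((a + b + c : ℕ) : ℤ) • (Pi.single 0 1 : Site 3)]) ≤
          criticalCorr 3 2 ![((0 : ℕ) : ℤ) • (Pi.single 0 1 : Site 3), (a : ℤ) • (Pi.single 0 1 : Site 3)] *
              criticalCorr 3 2 ![((a + b : ℕ) : ℤ) • (Pi.single 0 1 : Site 3),
                ((a + b + c : ℕ) : ℤ) • (Pi.single 0 1 : Site 3)] *
            (criticalCorr 3 2 ![((0 : ℕ) : ℤ) • (Pi.single 0 1 : Site 3),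
                ((a + b + c : ℕ) : ℤ) • (Pi.single 0 1 : Site 3)] *
              criticalCorr 3 2 ![(a : ℤ) • (Pi.single 0 1 : Site 3),
                ((a + b : ℕ) : ℤ) • (Pi.single 0 1 : Site 3)]) := by
  constructor
  · intro h a b c
    rcases Nat.eq_zero_or_pos a with rfl | ha
    · simp only [Nat.zero_add]
      rw [criticalCorr_four_dup01, criticalCorr_two_self]
      exact le_of_eq (by ring)
    rcases Nat.eq_zero_or_pos b with rfl | hb
    · simp only [add_zero]
      rw [criticalCorr_four_dup12, criticalCorr_two_self]
      exact le_of_eq (by ring)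
    rcases Nat.eq_zero_or_pos c with rfl | hc
    · simp only [add_zero]
      rw [criticalCorr_four_dup23, criticalCorr_two_self]
      exact le_of_eq (by ring)
    exact h a b c ha hb hc
  · intro h a b c _ _ _
    exact h a b c

/-- **Tightness**: the STRICT all-gaps strengthening of the crux is FALSE — at `(a,b,c) = (1,0,1)` the two
middle points coincide and the two sides are equal. (Informally the margin also closes in the interior,
`ρ(a,b,c) → 1` in both OPE corners; only the boundary case is a theorem.) [folklore] -/
theorem not_interlacing_strict_allGaps :
    ¬ ∀ a b c : ℕ,
        criticalCorr 3 4 ![((0 : ℕ) : ℤ) • (Pi.single 0 1 : Site 3), (a : ℤ) • (Pi.single 0 1 : Site 3),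
            ((a + b : ℕ) : ℤ) • (Pi.single 0 1 : Site 3), ((a + b + c : ℕ) : ℤ) • (Pi.single 0 1 : Site 3)] *
            (criticalCorr 3 2 ![((0 : ℕ) : ℤ) • (Pi.single 0 1 : Site 3),
                ((a + b : ℕ) : ℤ) • (Pi.single 0 1 : Site 3)] *
              criticalCorr 3 2 ![(a : ℤ) • (Pi.single 0 1 : Site 3),
                ((a + b + c : ℕ) : ℤ) • (Pi.single 0 1 : Site 3)]) <
          criticalCorr 3 2 ![((0 : ℕ) : ℤ) • (Pi.single 0 1 : Site 3), (a : ℤ) • (Pi.single 0 1 : Site 3)] *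
              criticalCorr 3 2 ![((a + b : ℕ) : ℤ) • (Pi.single 0 1 : Site 3),
                ((a + b + c : ℕ) : ℤ) • (Pi.single 0 1 : Site 3)] *
            (criticalCorr 3 2 ![((0 : ℕ) : ℤ) • (Pi.single 0 1 : Site 3),
                ((a + b + c : ℕ) : ℤ) • (Pi.single 0 1 : Site 3)] *
              criticalCorr 3 2 ![(a : ℤ) • (Pi.single 0 1 : Site 3),
                ((a + b : ℕ) : ℤ) • (Pi.single 0 1 : Site 3)]) := by
  intro h
  have h1 := h 1 0 1
  simp only [add_zero] at h1
  rw [criticalCorr_four_dup12, criticalCorr_two_self] at h1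
  exact (lt_irrefl _) (lt_of_lt_of_eq h1 (by ring))

/-! ### The Gaussian caricature and the threshold `log₂(1+√2)` -/

/-- `2^{-s}(2 + 2^{-s}) ≤ 1 ↔ log₂(1+√2) ≤ s` (with `t = 2^s`: `2t + 1 ≤ t²`, i.e. `t ≥ 1 + √2`). [folklore] -/
theorem two_rpow_neg_mul_le_one_iff (s : ℝ) :
    (2 : ℝ) ^ (-s) * (2 + (2 : ℝ) ^ (-s)) ≤ 1 ↔ Real.logb 2 (1 + Real.sqrt 2) ≤ s := by
  have h2 : (0 : ℝ) < 2 := by norm_num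
  have hs2 : Real.sqrt 2 ^ 2 = 2 := Real.sq_sqrt h2.le
  have hs0 : 0 ≤ Real.sqrt 2 := Real.sqrt_nonneg 2
  have ht : 0 < (2 : ℝ) ^ s := Real.rpow_pos_of_pos h2 s
  rw [Real.logb_le_iff_le_rpow (by norm_num : (1 : ℝ) < 2) (by positivity), Real.rpow_neg h2.le s]
  set t : ℝ := (2 : ℝ) ^ s with ht_def
  have hsq : (1 : ℝ) < Real.sqrt 2 := by nlinarith [hs2, hs0]
  constructor
  · intro h
    have h' : 2 * t + 1 ≤ t ^ 2 := by
      have e1 : t⁻¹ * (2 + t⁻¹) * t ^ 2 = 2 * t + 1 := by field_simp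
      have := mul_le_mul_of_nonneg_right h (sq_nonneg t)
      rw [e1, one_mul] at this
      exact this
    by_contra hcon
    have hlt : t < 1 + Real.sqrt 2 := lt_of_not_ge hcon
    have hprod : 0 < (1 + Real.sqrt 2 - t) * (t - 1 + Real.sqrt 2) :=
      mul_pos (sub_pos.mpr hlt) (by linarith)
    nlinarith [hprod, hs2, h']
  · intro h
    have h' : 2 * t + 1 ≤ t ^ 2 := by nlinarith [hs2, hs0, ht, h]
    have e1 : t⁻¹ * (2 + t⁻¹) = (2 * t + 1) / t ^ 2 := by field_simp
    rw [e1, div_le_one (by positivity)]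
    exact h'

/-- **Gaussian threshold at the balanced quadruple.** For the Wick law built on `g n = n^{-s}`
(`S₄ = G₁₂G₃₄ + G₁₃G₂₄ + G₁₄G₂₃`), the sub-Ptolemy inequality at the Ptolemy-balanced axis quadruple
`(0,2,3,6)·e₁` (gaps `(2,1,3)`, cross-ratio `½`; distances `d₁₂ = 2`, `d₃₄ = 3`, `d₁₃ = 3`, `d₂₄ = 4`, `d₁₄ = 6`,
`d₂₃ = 1`) holds IFF `log₂(1+√2) ≤ s ≈ 1.2716`: with `x = 2^{-s}`, `y = 3^{-s}` the sides are `x³y²(2+x)` and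
`x²y²`. This is the exact Gaussian threshold of the route (`2·2^{-2Δ} + 4^{-2Δ} > 1 ⇔ 2Δ < log₂(1+√2)`). [folklore] -/
theorem wickSPC_balanced_iff (s : ℝ) {g : ℕ → ℝ} (hg : ∀ n : ℕ, g n = (n : ℝ) ^ (-s)) :
    (g 2 * g 3 + g 3 * g 4 + g 6 * g 1) * (g 3 * g 4) ≤ g 2 * g 3 * (g 6 * g 1) ↔
      Real.logb 2 (1 + Real.sqrt 2) ≤ s := by
  rw [← two_rpow_neg_mul_le_one_iff]
  have h1 : g 1 = 1 := by simp [hg]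
  have h4 : g 4 = g 2 * g 2 := by
    rw [hg, hg, show ((4 : ℕ) : ℝ) = (2 : ℕ) * (2 : ℕ) by norm_num]
    exact Real.mul_rpow (by norm_num) (by norm_num)
  have h6 : g 6 = g 2 * g 3 := by
    rw [hg, hg, hg, show ((6 : ℕ) : ℝ) = (2 : ℕ) * (3 : ℕ) by norm_num]
    exact Real.mul_rpow (by norm_num) (by norm_num)
  have hx : 0 < g 2 := by rw [hg]; exact Real.rpow_pos_of_pos (by norm_num) _
  have hy : 0 < g 3 := by rw [hg]; exact Real.rpow_pos_of_pos (by norm_num) _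
  have hx2 : (2 : ℝ) ^ (-s) = g 2 := by rw [hg]; norm_num
  rw [h4, h6, h1, hx2]
  set x := g 2
  set y := g 3
  have hxy : 0 < x ^ 2 * y ^ 2 := by positivity
  constructor
  · intro h
    by_contra h'
    have h'' : 1 < x * (2 + x) := lt_of_not_ge h'
    have : x ^ 2 * y ^ 2 * 1 < x ^ 2 * y ^ 2 * (x * (2 + x)) := mul_lt_mul_of_pos_left h'' hxy
    nlinarith [this, h]
  · intro h
    have : x ^ 2 * y ^ 2 * (x * (2 + x)) ≤ x ^ 2 * y ^ 2 * 1 := mul_le_mul_of_nonneg_left h hxy.le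
    nlinarith [this]

/-- **The Gaussian analog of the crux fails throughout the route's window.** For every exponent
`s < log₂(1+√2)` the Wick law on `n^{-s}` violates the interlacing inequality at the gaps `(2,1,3)`; hence
`Interlacing` is not a consequence of any property the critical `ℤ³` law shares with such Gaussian laws
(GKS, reflection positivity, Gaussian domination, pairing-sum bounds à la Lebowitz / Newman). [folklore] -/
theorem not_wickSPC_of_lt_threshold {s : ℝ} (hs : s < Real.logb 2 (1 + Real.sqrt 2)) {g : ℕ → ℝ}
    (hg : ∀ n : ℕ, g n = (n : ℝ) ^ (-s)) :
    ¬ ∀ a b c : ℕ, 1 ≤ a → 1 ≤ b → 1 ≤ c →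
        (g a * g c + g (a + b) * g (b + c) + g (a + b + c) * g b) * (g (a + b) * g (b + c)) ≤
          g a * g c * (g (a + b + c) * g b) := by
  intro h
  have h213 := h 2 1 3 (by norm_num) (by norm_num) (by norm_num)
  norm_num at h213
  exact (not_le.mpr hs) ((wickSPC_balanced_iff s hg).mp h213)

/-- The `ℤ³`-GFF / mean-field exponent `s = 1` (`G ~ |x|^{-1}`, `η = 0`): the Gaussian analog is FALSE. [folklore] -/
theorem not_wickSPC_one {g : ℕ → ℝ} (hg : ∀ n : ℕ, g n = (n : ℝ) ^ (-(1 : ℝ))) :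
    ¬ ∀ a b c : ℕ, 1 ≤ a → 1 ≤ b → 1 ≤ c →
        (g a * g c + g (a + b) * g (b + c) + g (a + b + c) * g b) * (g (a + b) * g (b + c)) ≤
          g a * g c * (g (a + b + c) * g b) :=
  not_wickSPC_of_lt_threshold SubPtolemyFloorNegative.one_lt_threshold hg

/-- In the window `2Δ < log₂(1+√2)` demanded by the sibling crux `SubPtolemyFloor`, the Gaussian analog with
two-point exponent `2Δ` is FALSE: exactly where the route pays off, SPC is an anti-Gaussian statement. [folklore] -/
theorem not_wickSPC_of_window {Δ : ℝ} (hΔ : 2 * Δ < Real.logb 2 (1 + Real.sqrt 2)) {g : ℕ → ℝ}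
    (hg : ∀ n : ℕ, g n = (n : ℝ) ^ (-(2 * Δ))) :
    ¬ ∀ a b c : ℕ, 1 ≤ a → 1 ≤ b → 1 ≤ c →
        (g a * g c + g (a + b) * g (b + c) + g (a + b + c) * g b) * (g (a + b) * g (b + c)) ≤
          g a * g c * (g (a + b + c) * g b) :=
  not_wickSPC_of_lt_threshold hΔ hg

/-- Above the threshold the balanced instance HOLDS for the Wick law, e.g. at the mean-field exponent
`s = 2 = d - 2` of `d = 4`: the dimension dependence of the route enters only through `s`. [folklore] -/
theorem wickSPC_two_balanced {g : ℕ → ℝ} (hg : ∀ n : ℕ, g n = (n : ℝ) ^ (-(2 : ℝ))) :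
    (g 2 * g 3 + g 3 * g 4 + g 6 * g 1) * (g 3 * g 4) ≤ g 2 * g 3 * (g 6 * g 1) :=
  (wickSPC_balanced_iff 2 hg).mpr SubPtolemyFloorNegative.threshold_lt_two.le

/-! ### Calibration on chains: identity, and the interlaced slot is load-bearing -/

/-- For every multiplicative axial law `G(i,j) = t^{j-i}` with `S₄ = t^{a}·t^{c}` (nearest-neighbour Ising
chain, `t = tanh β`; any tree) the interlacing inequality is an IDENTITY. [folklore] -/
theorem chain_spc_eq (t : ℝ) (a b c : ℕ) :
    t ^ a * t ^ c * (t ^ (a + b) * t ^ (b + c)) = t ^ a * t ^ c * (t ^ (a + b + c) * t ^ b) := by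
  ring

/-- Penalising the ADJACENT pairing `(12)(34)` instead of the crossing pairing `(13)(24)` is FALSE already on
the chain (`t = 1/2`, gaps `(1,1,1)`: `t⁴ ≤ t⁸` fails): the interlaced assignment is load-bearing. [folklore] -/
theorem not_chain_adjacent_penalised :
    ¬ ∀ (t : ℝ), 0 < t → t < 1 → ∀ a b c : ℕ, 1 ≤ a → 1 ≤ b → 1 ≤ c →
      t ^ a * t ^ c * (t ^ a * t ^ c) ≤ t ^ (a + b) * t ^ (b + c) * (t ^ (a + b + c) * t ^ b) := by
  intro h
  have := h (1 / 2) (by norm_num) (by norm_num) 1 1 1 le_rfl le_rfl le_rfl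
  norm_num at this

/-! ### Channel form: where the margin closes -/

/-- **Channel form of SPC.** `S₄P₂ ≤ P₁P₃ ↔ (S₄ - P₁)·P₂ ≤ P₁·(P₃ - P₂)`: the excess of the four-point
function over the adjacent pairing, weighted by the crossing pairing, against the adjacent pairing times the
reflection-positivity defect `P₃ - P₂ ≥ 0`. In the corner `a = c = 1`, `b → ∞` this is
`Cov(σ₀σ₁, σ_{b+1}σ_{b+2})·G(b+1)² ≤ G(1)²·(G(b)G(b+2) - G(b+1)²)` (energy–energy covariance `~ b^{-2Δ_ε}`
against curvature `~ 2Δ G(b)²/b²`), the only corner where `ρ → 1`. [folklore] -/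
theorem spc_iff_excess_le_defect (S4 P₁ P₂ P₃ : ℝ) :
    S4 * P₂ ≤ P₁ * P₃ ↔ (S4 - P₁) * P₂ ≤ P₁ * (P₃ - P₂) := by
  constructor <;> intro h <;> nlinarith [h]

/-- **Channel-ratio form.** For positive pairings, `S₄P₂ ≤ P₁P₃ ↔ S₄/P₁ ≤ P₃/P₂` (`= t ≥ 1`, the
two-point cross-ratio): the `(12)(34)`-channel normalised four-point function is bounded by a TWO-POINT
quantity. [folklore] -/
theorem spc_iff_channel_ratio {S4 P₁ P₂ P₃ : ℝ} (hP₁ : 0 < P₁) (hP₂ : 0 < P₂) :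
    S4 * P₂ ≤ P₁ * P₃ ↔ S4 / P₁ ≤ P₃ / P₂ := by
  rw [div_le_div_iff₀ hP₁ hP₂, mul_comm P₃ P₁]

/-! ### Off the line: equidistant quadruples -/

/-- **Equidistant quadruples.** If all six pair weights equal `G > 0` (e.g. the lattice tetrahedron
`{0, e₁+e₂, e₁+e₃, e₂+e₃} ⊂ ℤ³`, one point-group orbit), the sub-Ptolemy inequality with any penalised
pairing is `S₄ ≤ G²`; with Griffiths II (`S₄ ≥ G²`) it would force exact factorisation. Hence the
off-line / non-concyclic extension of the crux is not a candidate strengthening (continuum face: `g(1,1) ≤ 1`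
fails in every unitary CFT). [folklore] -/
theorem spc_equidistant_iff {G S4 : ℝ} (hG : 0 < G) :
    S4 * (G * G) ≤ G * G * (G * G) ↔ S4 ≤ G * G := by
  rw [mul_le_mul_iff_left₀ (mul_pos hG hG)]

/-! ### The picked line's engine needs a quantitative meeting bound -/

/-- **The engine's displayed inputs are insufficient** (line `Sketch`, stub 7). There are pairing weights
`P₁, P₂, P₃ > 0` and a four-point value `S₄` satisfying MMS monotonicity (`P₂ ≤ P₁`), RP log-convexity
(`P₂ ≤ P₃`), Griffiths II (`S₄ ≥` each pairing), Lebowitz (`S₄ ≤ P₁+P₂+P₃`) and the non-Lebowitz-regime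
hypothesis `(P₁-P₂)(P₃-P₂) < 2P₂²`, for which SPC FAILS (`P₁P₃ < S₄P₂`). Witness: the Wick values at gaps
`(2,1,3)` with `G(n) = 1/n` — `P₁ = P₃ = 1/6`, `P₂ = 1/12`, `S₄ = 5/12` (meeting probability `0`). So stub 7
can only be proved by a QUANTITATIVE lower bound on the interlaced meeting probability
(`≥ ι* = 1 - (u-1)(t-1)/2`, up to `0.448` at `2Δ = 1.036`). [folklore] -/
theorem engine_inputs_insufficient :
    ∃ P₁ P₂ P₃ S4 : ℝ, 0 < P₂ ∧ P₂ ≤ P₁ ∧ P₂ ≤ P₃ ∧ P₁ ≤ S4 ∧ P₂ ≤ S4 ∧ P₃ ≤ S4 ∧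
      S4 ≤ P₁ + P₂ + P₃ ∧ (P₁ - P₂) * (P₃ - P₂) < 2 * P₂ ^ 2 ∧ P₁ * P₃ < S4 * P₂ :=
  ⟨1 / 6, 1 / 12, 1 / 6, 5 / 12, by norm_num⟩

end Summit.CriticalPhenomena.Ising3DConformalLimit.InterlacingNegative
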